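import Summits.BirchSwinnertonDyer.Rank1Residual.X10.ResidualSelmerParityRecordsB
import Summits.BirchSwinnertonDyer.Rank1Residual.X10.ResidualSelmerCompanions
import HarnessLib

/-!
# N2 (X10b @ 3) COMPANION RECORDS, part B — NO UNIT COMPANION for 12 parity-odd N2 cells:
# every Tamagawa-`3`-free good-at-`3` curve `3`-congruent to the cell has `Sel₃ ≠ 0`
# (cell `b2b-bsdres`, unit `b2b-bsdres-x10` = N2 class lead, GEN 32; per-cell RECORDS — theorems only,
# no definition, named-fact hypotheses `poitouTate_selmerStructure_duality ℚ` and `hMR`, nothing booked)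

HONEST FRAMING (run/shared/lean/b2b/bsd-rank1-residual/, verbatim in every file): the goal of the
cell is to DELETE the COMBINATION-SHAPED residual classes of the Birch–Swinnerton-Dyer formula for
ALL analytic-rank `≤ 1` elliptic curves over `ℚ` — "full BSD formula for every rank `≤ 1` curve in
class `C`" assembled STRICTLY from published theorems — so that the rank-`≤ 1` remainder becomes
exactly the CONSTRUCTION-SHAPED classes, which are TYPED (missing-input `Prop`s), NOT attempted.
This is not "finishing BSD". Class X10b (= N2) keeps its label CONSTRUCTION-SHAPED (NEEDS `X_A3`,
referee R82.3 / RESIDUAL-MAP §I N2); these are RECORDS (evidence about the reach of the trivial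
roads, TRIVIAL-ROADS memo (P)/(C2)); no mark / label / tier / count of record moves.

## What (x10 GEN 32, X10-AUDIT §38; parts A–F as `X10/ResidualSelmerParityRecords{A..F}`)

Per cell `E` of `X10/ResidualSelmerParityRecordsB` (the parity record
`residualSelmerGroup_ne_bot_e<E>`: `S⁰(E) ≠ ⊥`, `E`-side in the kernel, census `#Sel₃(E) = 3^s`,
Poitou–Tate fact `hfact`) and the `S⁰`-COMPANIONS tool
(`X10/ResidualSelmerCompanions.natCard_selmerGroup_ne_one_of_congr_of_residualSelmerGroup_ne_bot`:
`S⁰` transports along `θ : A[3] ⥲ E[3]` when both curves are good at `3` — Mazur–Rubin 2015 Thm. 3.1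
(iv)(b), the named fact `hMR` —, and `S⁰(A) = Sel₃(A)` for Tamagawa-`3`-free `A`, fact-free):
* `no_unit_companion_e<E>` — for EVERY elliptic curve `A / ℚ` with a `Γ_ℚ`-isomorphism
  `θ : A[3] ⥲ E[3]` (EVIDENCE per pair: a KO-certified row, a Hesse / dual-Hesse certificate), good at
  `3`, `3 ∤ ∏ c_ℓ(A)`: **`#Sel₃(A) ≠ 1`** — no UNIT curve is `3`-congruent to `E`; `E`'s good reduction
  at `3` is read off the integral model (`3 ∤ Δ(E₀)`, `decide +kernel`).
THE N2 READING: the unit road (GEN 24/26) and the Tamagawa-free trivial-partner road (GEN 24–26) to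
`X_A3` are closed for these cells EVERYWHERE (memo TRIVIAL-ROADS §3: NOGO-parity), not only in
Cremona's range. CONDITIONAL on `hfact` and `hMR`; census `hs`; per cell; nothing booked. Generator
`HOME/b2b-bsdres-x10/g32/gen/mkcompanion32.py`.

References: [MazurRubin2007] Def. 1.2, Prop. 1.3 (i), Thm. 1.4; [MazurRubin2015SelmerCompanions]
Thm. 3.1 (iv)(b); [SilvermanAEC2009] VII.5 Prop. 5.1 (a); [Cremona2006] Table 1 (labels as
displayed); HOME/class-closure/N2/TRIVIAL-ROADS-x10g27.md §3; HOME/X10-AUDIT.md §38.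
-/

set_option autoImplicit false

noncomputable section

open scoped Classical

open WeierstrassCurve Literature.NumberTheory.EllipticCurves Literature.NumberTheory.GaloisRepresentations
  Literature.NumberTheory.GaloisCohomology NumberField IsDedekindDomain Field
open Literature.NumberTheory.EllipticCurves.MazurRubin2015
open Summit.BirchSwinnertonDyer.Rank1Residual.X10.SelmerCompanionsTamagawaFree
open Summit.BirchSwinnertonDyer.Rank1Residual.X10.ResidualSelmerGroup
open Summit.BirchSwinnertonDyer.Rank1Residual.X10.ResidualSelmerParityRecords
open Summit.BirchSwinnertonDyer.Rank1Residual.X10.ResidualSelmerCompanions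

namespace Summit.BirchSwinnertonDyer.Rank1Residual.X10.ResidualSelmerCompanionRecords

/-! ### `190463cc1` -/

/-- **NO UNIT COMPANION for `190463cc1`** (NOGO-parity verdict cell; `S⁰(190463cc1) ≠ 0` =
`ResidualSelmerParityRecords.residualSelmerGroup_ne_bot_e190463cc1`, census `#Sel₃ = 1`): every Tamagawa-`3`-free
good-at-`3` curve `A` with a `Γ_ℚ`-isomorphism `θ : A[3] ⥲ E[3]` has `#Sel₃(A) ≠ 1`. `E` good at `3` by `3 ∤ Δ(E₀)`
(kernel). CONDITIONAL on the Poitou–Tate fact and `hMR`; per cell; nothing booked.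
[cite: MazurRubin2007, Thm. 1.4] [cite: MazurRubin2015SelmerCompanions, Thm. 3.1 (iv)(b)]
[cite: Cremona2006, Table 1 (Cremona label 190463cc1)] -/
theorem no_unit_companion_e190463cc1 (hfact : poitouTate_selmerStructure_duality ℚ)
    (hMR : selmerLocalKer_iff_of_goodReduction_above)
    (W : WeierstrassCurve ℚ) [W.IsElliptic] [W.IsGloballyMinimal]
    (hI : integralModelInt W = ⟨0, (-1), 1, (-15322610), (-22818290363)⟩)
    (hs : Nat.card (W.selmerGroup (3 : ℤ)) = 1)
    (A : WeierstrassCurve ℚ) [A.IsElliptic] (θ : geomTorsion A (3 : ℤ) ≃+ geomTorsion W (3 : ℤ))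
    (hθ : ∀ (σ : absoluteGaloisGroup ℚ) (P : geomTorsion A (3 : ℤ)), θ (σ • P) = σ • θ P)
    (hgoodA : ∀ v : HeightOneSpectrum (𝓞 ℚ), (3 : 𝓞 ℚ) ∈ v.asIdeal → A.HasGoodReductionAt v)
    (htamA : ¬ 3 ∣ A.tamagawaProduct) : Nat.card (A.selmerGroup (3 : ℤ)) ≠ 1 :=
  natCard_selmerGroup_ne_one_of_congr_of_residualSelmerGroup_ne_bot W A 3 hMR (by decide) θ hθ
    (fun v hv ↦ ⟨hasGoodReductionAt_of_map_eq_of_not_dvd (p := 3) W (hI ▸ map_integralModelInt W)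
      (by decide +kernel) v hv, hgoodA v (by exact_mod_cast hv)⟩)
    htamA (residualSelmerGroup_ne_bot_e190463cc1 hfact W hI hs)

/-! ### `190463h1` -/

/-- **NO UNIT COMPANION for `190463h1`** (NOGO-parity verdict cell; `S⁰(190463h1) ≠ 0` =
`ResidualSelmerParityRecords.residualSelmerGroup_ne_bot_e190463h1`, census `#Sel₃ = 1`): every Tamagawa-`3`-free
good-at-`3` curve `A` with a `Γ_ℚ`-isomorphism `θ : A[3] ⥲ E[3]` has `#Sel₃(A) ≠ 1`. `E` good at `3` by `3 ∤ Δ(E₀)`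
(kernel). CONDITIONAL on the Poitou–Tate fact and `hMR`; per cell; nothing booked.
[cite: MazurRubin2007, Thm. 1.4] [cite: MazurRubin2015SelmerCompanions, Thm. 3.1 (iv)(b)]
[cite: Cremona2006, Table 1 (Cremona label 190463h1)] -/
theorem no_unit_companion_e190463h1 (hfact : poitouTate_selmerStructure_duality ℚ)
    (hMR : selmerLocalKer_iff_of_goodReduction_above)
    (W : WeierstrassCurve ℚ) [W.IsElliptic] [W.IsGloballyMinimal]
    (hI : integralModelInt W = ⟨0, (-1), 1, (-90666), (-10358216)⟩)
    (hs : Nat.card (W.selmerGroup (3 : ℤ)) = 1)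
    (A : WeierstrassCurve ℚ) [A.IsElliptic] (θ : geomTorsion A (3 : ℤ) ≃+ geomTorsion W (3 : ℤ))
    (hθ : ∀ (σ : absoluteGaloisGroup ℚ) (P : geomTorsion A (3 : ℤ)), θ (σ • P) = σ • θ P)
    (hgoodA : ∀ v : HeightOneSpectrum (𝓞 ℚ), (3 : 𝓞 ℚ) ∈ v.asIdeal → A.HasGoodReductionAt v)
    (htamA : ¬ 3 ∣ A.tamagawaProduct) : Nat.card (A.selmerGroup (3 : ℤ)) ≠ 1 :=
  natCard_selmerGroup_ne_one_of_congr_of_residualSelmerGroup_ne_bot W A 3 hMR (by decide) θ hθ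
    (fun v hv ↦ ⟨hasGoodReductionAt_of_map_eq_of_not_dvd (p := 3) W (hI ▸ map_integralModelInt W)
      (by decide +kernel) v hv, hgoodA v (by exact_mod_cast hv)⟩)
    htamA (residualSelmerGroup_ne_bot_e190463h1 hfact W hI hs)

/-! ### `204490bp1` -/

/-- **NO UNIT COMPANION for `204490bp1`** (NOGO-parity verdict cell; `S⁰(204490bp1) ≠ 0` =
`ResidualSelmerParityRecords.residualSelmerGroup_ne_bot_e204490bp1`, census `#Sel₃ = 1`): every Tamagawa-`3`-free
good-at-`3` curve `A` with a `Γ_ℚ`-isomorphism `θ : A[3] ⥲ E[3]` has `#Sel₃(A) ≠ 1`. `E` good at `3` by `3 ∤ Δ(E₀)`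
(kernel). CONDITIONAL on the Poitou–Tate fact and `hMR`; per cell; nothing booked.
[cite: MazurRubin2007, Thm. 1.4] [cite: MazurRubin2015SelmerCompanions, Thm. 3.1 (iv)(b)]
[cite: Cremona2006, Table 1 (Cremona label 204490bp1)] -/
theorem no_unit_companion_e204490bp1 (hfact : poitouTate_selmerStructure_duality ℚ)
    (hMR : selmerLocalKer_iff_of_goodReduction_above)
    (W : WeierstrassCurve ℚ) [W.IsElliptic] [W.IsGloballyMinimal]
    (hI : integralModelInt W = ⟨1, 1, 1, (-8291), 107713⟩)
    (hs : Nat.card (W.selmerGroup (3 : ℤ)) = 1)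
    (A : WeierstrassCurve ℚ) [A.IsElliptic] (θ : geomTorsion A (3 : ℤ) ≃+ geomTorsion W (3 : ℤ))
    (hθ : ∀ (σ : absoluteGaloisGroup ℚ) (P : geomTorsion A (3 : ℤ)), θ (σ • P) = σ • θ P)
    (hgoodA : ∀ v : HeightOneSpectrum (𝓞 ℚ), (3 : 𝓞 ℚ) ∈ v.asIdeal → A.HasGoodReductionAt v)
    (htamA : ¬ 3 ∣ A.tamagawaProduct) : Nat.card (A.selmerGroup (3 : ℤ)) ≠ 1 :=
  natCard_selmerGroup_ne_one_of_congr_of_residualSelmerGroup_ne_bot W A 3 hMR (by decide) θ hθ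
    (fun v hv ↦ ⟨hasGoodReductionAt_of_map_eq_of_not_dvd (p := 3) W (hI ▸ map_integralModelInt W)
      (by decide +kernel) v hv, hgoodA v (by exact_mod_cast hv)⟩)
    htamA (residualSelmerGroup_ne_bot_e204490bp1 hfact W hI hs)

/-! ### `204490dc1` -/

/-- **NO UNIT COMPANION for `204490dc1`** (NOGO-parity verdict cell; `S⁰(204490dc1) ≠ 0` =
`ResidualSelmerParityRecords.residualSelmerGroup_ne_bot_e204490dc1`, census `#Sel₃ = 1`): every Tamagawa-`3`-free
good-at-`3` curve `A` with a `Γ_ℚ`-isomorphism `θ : A[3] ⥲ E[3]` has `#Sel₃(A) ≠ 1`. `E` good at `3` by `3 ∤ Δ(E₀)`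
(kernel). CONDITIONAL on the Poitou–Tate fact and `hMR`; per cell; nothing booked.
[cite: MazurRubin2007, Thm. 1.4] [cite: MazurRubin2015SelmerCompanions, Thm. 3.1 (iv)(b)]
[cite: Cremona2006, Table 1 (Cremona label 204490dc1)] -/
theorem no_unit_companion_e204490dc1 (hfact : poitouTate_selmerStructure_duality ℚ)
    (hMR : selmerLocalKer_iff_of_goodReduction_above)
    (W : WeierstrassCurve ℚ) [W.IsElliptic] [W.IsGloballyMinimal]
    (hI : integralModelInt W = ⟨1, 1, 0, (-1401182), 243651764⟩)
    (hs : Nat.card (W.selmerGroup (3 : ℤ)) = 1)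
    (A : WeierstrassCurve ℚ) [A.IsElliptic] (θ : geomTorsion A (3 : ℤ) ≃+ geomTorsion W (3 : ℤ))
    (hθ : ∀ (σ : absoluteGaloisGroup ℚ) (P : geomTorsion A (3 : ℤ)), θ (σ • P) = σ • θ P)
    (hgoodA : ∀ v : HeightOneSpectrum (𝓞 ℚ), (3 : 𝓞 ℚ) ∈ v.asIdeal → A.HasGoodReductionAt v)
    (htamA : ¬ 3 ∣ A.tamagawaProduct) : Nat.card (A.selmerGroup (3 : ℤ)) ≠ 1 :=
  natCard_selmerGroup_ne_one_of_congr_of_residualSelmerGroup_ne_bot W A 3 hMR (by decide) θ hθ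
    (fun v hv ↦ ⟨hasGoodReductionAt_of_map_eq_of_not_dvd (p := 3) W (hI ▸ map_integralModelInt W)
      (by decide +kernel) v hv, hgoodA v (by exact_mod_cast hv)⟩)
    htamA (residualSelmerGroup_ne_bot_e204490dc1 hfact W hI hs)

/-! ### `308896n1` -/

/-- **NO UNIT COMPANION for `308896n1`** (NOGO-parity verdict cell; `S⁰(308896n1) ≠ 0` =
`ResidualSelmerParityRecords.residualSelmerGroup_ne_bot_e308896n1`, census `#Sel₃ = 1`): every Tamagawa-`3`-free
good-at-`3` curve `A` with a `Γ_ℚ`-isomorphism `θ : A[3] ⥲ E[3]` has `#Sel₃(A) ≠ 1`. `E` good at `3` by `3 ∤ Δ(E₀)`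
(kernel). CONDITIONAL on the Poitou–Tate fact and `hMR`; per cell; nothing booked.
[cite: MazurRubin2007, Thm. 1.4] [cite: MazurRubin2015SelmerCompanions, Thm. 3.1 (iv)(b)]
[cite: Cremona2006, Table 1 (Cremona label 308896n1)] -/
theorem no_unit_companion_e308896n1 (hfact : poitouTate_selmerStructure_duality ℚ)
    (hMR : selmerLocalKer_iff_of_goodReduction_above)
    (W : WeierstrassCurve ℚ) [W.IsElliptic] [W.IsGloballyMinimal]
    (hI : integralModelInt W = ⟨0, (-1), 0, (-11880605), 15765858613⟩)
    (hs : Nat.card (W.selmerGroup (3 : ℤ)) = 1)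
    (A : WeierstrassCurve ℚ) [A.IsElliptic] (θ : geomTorsion A (3 : ℤ) ≃+ geomTorsion W (3 : ℤ))
    (hθ : ∀ (σ : absoluteGaloisGroup ℚ) (P : geomTorsion A (3 : ℤ)), θ (σ • P) = σ • θ P)
    (hgoodA : ∀ v : HeightOneSpectrum (𝓞 ℚ), (3 : 𝓞 ℚ) ∈ v.asIdeal → A.HasGoodReductionAt v)
    (htamA : ¬ 3 ∣ A.tamagawaProduct) : Nat.card (A.selmerGroup (3 : ℤ)) ≠ 1 :=
  natCard_selmerGroup_ne_one_of_congr_of_residualSelmerGroup_ne_bot W A 3 hMR (by decide) θ hθ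
    (fun v hv ↦ ⟨hasGoodReductionAt_of_map_eq_of_not_dvd (p := 3) W (hI ▸ map_integralModelInt W)
      (by decide +kernel) v hv, hgoodA v (by exact_mod_cast hv)⟩)
    htamA (residualSelmerGroup_ne_bot_e308896n1 hfact W hI hs)

/-! ### `336973q1` -/

/-- **NO UNIT COMPANION for `336973q1`** (NOGO-parity verdict cell; `S⁰(336973q1) ≠ 0` =
`ResidualSelmerParityRecords.residualSelmerGroup_ne_bot_e336973q1`, census `#Sel₃ = 1`): every Tamagawa-`3`-free
good-at-`3` curve `A` with a `Γ_ℚ`-isomorphism `θ : A[3] ⥲ E[3]` has `#Sel₃(A) ≠ 1`. `E` good at `3` by `3 ∤ Δ(E₀)`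
(kernel). CONDITIONAL on the Poitou–Tate fact and `hMR`; per cell; nothing booked.
[cite: MazurRubin2007, Thm. 1.4] [cite: MazurRubin2015SelmerCompanions, Thm. 3.1 (iv)(b)]
[cite: Cremona2006, Table 1 (Cremona label 336973q1)] -/
theorem no_unit_companion_e336973q1 (hfact : poitouTate_selmerStructure_duality ℚ)
    (hMR : selmerLocalKer_iff_of_goodReduction_above)
    (W : WeierstrassCurve ℚ) [W.IsElliptic] [W.IsGloballyMinimal]
    (hI : integralModelInt W = ⟨0, (-1), 1, 794911, (-1001891052)⟩)
    (hs : Nat.card (W.selmerGroup (3 : ℤ)) = 1)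
    (A : WeierstrassCurve ℚ) [A.IsElliptic] (θ : geomTorsion A (3 : ℤ) ≃+ geomTorsion W (3 : ℤ))
    (hθ : ∀ (σ : absoluteGaloisGroup ℚ) (P : geomTorsion A (3 : ℤ)), θ (σ • P) = σ • θ P)
    (hgoodA : ∀ v : HeightOneSpectrum (𝓞 ℚ), (3 : 𝓞 ℚ) ∈ v.asIdeal → A.HasGoodReductionAt v)
    (htamA : ¬ 3 ∣ A.tamagawaProduct) : Nat.card (A.selmerGroup (3 : ℤ)) ≠ 1 :=
  natCard_selmerGroup_ne_one_of_congr_of_residualSelmerGroup_ne_bot W A 3 hMR (by decide) θ hθ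
    (fun v hv ↦ ⟨hasGoodReductionAt_of_map_eq_of_not_dvd (p := 3) W (hI ▸ map_integralModelInt W)
      (by decide +kernel) v hv, hgoodA v (by exact_mod_cast hv)⟩)
    htamA (residualSelmerGroup_ne_bot_e336973q1 hfact W hI hs)

/-! ### `414050fb1` -/

/-- **NO UNIT COMPANION for `414050fb1`** (NOGO-parity verdict cell; `S⁰(414050fb1) ≠ 0` =
`ResidualSelmerParityRecords.residualSelmerGroup_ne_bot_e414050fb1`, census `#Sel₃ = 1`): every Tamagawa-`3`-free
good-at-`3` curve `A` with a `Γ_ℚ`-isomorphism `θ : A[3] ⥲ E[3]` has `#Sel₃(A) ≠ 1`. `E` good at `3` by `3 ∤ Δ(E₀)`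
(kernel). CONDITIONAL on the Poitou–Tate fact and `hMR`; per cell; nothing booked.
[cite: MazurRubin2007, Thm. 1.4] [cite: MazurRubin2015SelmerCompanions, Thm. 3.1 (iv)(b)]
[cite: Cremona2006, Table 1 (Cremona label 414050fb1)] -/
theorem no_unit_companion_e414050fb1 (hfact : poitouTate_selmerStructure_duality ℚ)
    (hMR : selmerLocalKer_iff_of_goodReduction_above)
    (W : WeierstrassCurve ℚ) [W.IsElliptic] [W.IsGloballyMinimal]
    (hI : integralModelInt W = ⟨1, 1, 1, 616762, 571431531⟩)
    (hs : Nat.card (W.selmerGroup (3 : ℤ)) = 1)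
    (A : WeierstrassCurve ℚ) [A.IsElliptic] (θ : geomTorsion A (3 : ℤ) ≃+ geomTorsion W (3 : ℤ))
    (hθ : ∀ (σ : absoluteGaloisGroup ℚ) (P : geomTorsion A (3 : ℤ)), θ (σ • P) = σ • θ P)
    (hgoodA : ∀ v : HeightOneSpectrum (𝓞 ℚ), (3 : 𝓞 ℚ) ∈ v.asIdeal → A.HasGoodReductionAt v)
    (htamA : ¬ 3 ∣ A.tamagawaProduct) : Nat.card (A.selmerGroup (3 : ℤ)) ≠ 1 :=
  natCard_selmerGroup_ne_one_of_congr_of_residualSelmerGroup_ne_bot W A 3 hMR (by decide) θ hθ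
    (fun v hv ↦ ⟨hasGoodReductionAt_of_map_eq_of_not_dvd (p := 3) W (hI ▸ map_integralModelInt W)
      (by decide +kernel) v hv, hgoodA v (by exact_mod_cast hv)⟩)
    htamA (residualSelmerGroup_ne_bot_e414050fb1 hfact W hI hs)

/-! ### `414050hk1` -/

/-- **NO UNIT COMPANION for `414050hk1`** (NOGO-parity verdict cell; `S⁰(414050hk1) ≠ 0` =
`ResidualSelmerParityRecords.residualSelmerGroup_ne_bot_e414050hk1`, census `#Sel₃ = 1`): every Tamagawa-`3`-free
good-at-`3` curve `A` with a `Γ_ℚ`-isomorphism `θ : A[3] ⥲ E[3]` has `#Sel₃(A) ≠ 1`. `E` good at `3` by `3 ∤ Δ(E₀)`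
(kernel). CONDITIONAL on the Poitou–Tate fact and `hMR`; per cell; nothing booked.
[cite: MazurRubin2007, Thm. 1.4] [cite: MazurRubin2015SelmerCompanions, Thm. 3.1 (iv)(b)]
[cite: Cremona2006, Table 1 (Cremona label 414050hk1)] -/
theorem no_unit_companion_e414050hk1 (hfact : poitouTate_selmerStructure_duality ℚ)
    (hMR : selmerLocalKer_iff_of_goodReduction_above)
    (W : WeierstrassCurve ℚ) [W.IsElliptic] [W.IsGloballyMinimal]
    (hI : integralModelInt W = ⟨1, 1, 1, (-83938), 3546031⟩)
    (hs : Nat.card (W.selmerGroup (3 : ℤ)) = 1)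
    (A : WeierstrassCurve ℚ) [A.IsElliptic] (θ : geomTorsion A (3 : ℤ) ≃+ geomTorsion W (3 : ℤ))
    (hθ : ∀ (σ : absoluteGaloisGroup ℚ) (P : geomTorsion A (3 : ℤ)), θ (σ • P) = σ • θ P)
    (hgoodA : ∀ v : HeightOneSpectrum (𝓞 ℚ), (3 : 𝓞 ℚ) ∈ v.asIdeal → A.HasGoodReductionAt v)
    (htamA : ¬ 3 ∣ A.tamagawaProduct) : Nat.card (A.selmerGroup (3 : ℤ)) ≠ 1 :=
  natCard_selmerGroup_ne_one_of_congr_of_residualSelmerGroup_ne_bot W A 3 hMR (by decide) θ hθ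
    (fun v hv ↦ ⟨hasGoodReductionAt_of_map_eq_of_not_dvd (p := 3) W (hI ▸ map_integralModelInt W)
      (by decide +kernel) v hv, hgoodA v (by exact_mod_cast hv)⟩)
    htamA (residualSelmerGroup_ne_bot_e414050hk1 hfact W hI hs)

/-! ### `438080bj1` -/

/-- **NO UNIT COMPANION for `438080bj1`** (NOGO-parity verdict cell; `S⁰(438080bj1) ≠ 0` =
`ResidualSelmerParityRecords.residualSelmerGroup_ne_bot_e438080bj1`, census `#Sel₃ = 1`): every Tamagawa-`3`-free
good-at-`3` curve `A` with a `Γ_ℚ`-isomorphism `θ : A[3] ⥲ E[3]` has `#Sel₃(A) ≠ 1`. `E` good at `3` by `3 ∤ Δ(E₀)`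
(kernel). CONDITIONAL on the Poitou–Tate fact and `hMR`; per cell; nothing booked.
[cite: MazurRubin2007, Thm. 1.4] [cite: MazurRubin2015SelmerCompanions, Thm. 3.1 (iv)(b)]
[cite: Cremona2006, Table 1 (Cremona label 438080bj1)] -/
theorem no_unit_companion_e438080bj1 (hfact : poitouTate_selmerStructure_duality ℚ)
    (hMR : selmerLocalKer_iff_of_goodReduction_above)
    (W : WeierstrassCurve ℚ) [W.IsElliptic] [W.IsGloballyMinimal]
    (hI : integralModelInt W = ⟨0, (-1), 0, (-1891045), (-836633725)⟩)
    (hs : Nat.card (W.selmerGroup (3 : ℤ)) = 1)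
    (A : WeierstrassCurve ℚ) [A.IsElliptic] (θ : geomTorsion A (3 : ℤ) ≃+ geomTorsion W (3 : ℤ))
    (hθ : ∀ (σ : absoluteGaloisGroup ℚ) (P : geomTorsion A (3 : ℤ)), θ (σ • P) = σ • θ P)
    (hgoodA : ∀ v : HeightOneSpectrum (𝓞 ℚ), (3 : 𝓞 ℚ) ∈ v.asIdeal → A.HasGoodReductionAt v)
    (htamA : ¬ 3 ∣ A.tamagawaProduct) : Nat.card (A.selmerGroup (3 : ℤ)) ≠ 1 :=
  natCard_selmerGroup_ne_one_of_congr_of_residualSelmerGroup_ne_bot W A 3 hMR (by decide) θ hθ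
    (fun v hv ↦ ⟨hasGoodReductionAt_of_map_eq_of_not_dvd (p := 3) W (hI ▸ map_integralModelInt W)
      (by decide +kernel) v hv, hgoodA v (by exact_mod_cast hv)⟩)
    htamA (residualSelmerGroup_ne_bot_e438080bj1 hfact W hI hs)

/-! ### `470450bd1` -/

/-- **NO UNIT COMPANION for `470450bd1`** (NOGO-parity verdict cell; `S⁰(470450bd1) ≠ 0` =
`ResidualSelmerParityRecords.residualSelmerGroup_ne_bot_e470450bd1`, census `#Sel₃ = 1`): every Tamagawa-`3`-free
good-at-`3` curve `A` with a `Γ_ℚ`-isomorphism `θ : A[3] ⥲ E[3]` has `#Sel₃(A) ≠ 1`. `E` good at `3` by `3 ∤ Δ(E₀)`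
(kernel). CONDITIONAL on the Poitou–Tate fact and `hMR`; per cell; nothing booked.
[cite: MazurRubin2007, Thm. 1.4] [cite: MazurRubin2015SelmerCompanions, Thm. 3.1 (iv)(b)]
[cite: Cremona2006, Table 1 (Cremona label 470450bd1)] -/
theorem no_unit_companion_e470450bd1 (hfact : poitouTate_selmerStructure_duality ℚ)
    (hMR : selmerLocalKer_iff_of_goodReduction_above)
    (W : WeierstrassCurve ℚ) [W.IsElliptic] [W.IsGloballyMinimal]
    (hI : integralModelInt W = ⟨1, 1, 1, 10933062, 165241282031⟩)
    (hs : Nat.card (W.selmerGroup (3 : ℤ)) = 1)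
    (A : WeierstrassCurve ℚ) [A.IsElliptic] (θ : geomTorsion A (3 : ℤ) ≃+ geomTorsion W (3 : ℤ))
    (hθ : ∀ (σ : absoluteGaloisGroup ℚ) (P : geomTorsion A (3 : ℤ)), θ (σ • P) = σ • θ P)
    (hgoodA : ∀ v : HeightOneSpectrum (𝓞 ℚ), (3 : 𝓞 ℚ) ∈ v.asIdeal → A.HasGoodReductionAt v)
    (htamA : ¬ 3 ∣ A.tamagawaProduct) : Nat.card (A.selmerGroup (3 : ℤ)) ≠ 1 :=
  natCard_selmerGroup_ne_one_of_congr_of_residualSelmerGroup_ne_bot W A 3 hMR (by decide) θ hθ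
    (fun v hv ↦ ⟨hasGoodReductionAt_of_map_eq_of_not_dvd (p := 3) W (hI ▸ map_integralModelInt W)
      (by decide +kernel) v hv, hgoodA v (by exact_mod_cast hv)⟩)
    htamA (residualSelmerGroup_ne_bot_e470450bd1 hfact W hI hs)

/-! ### `470450be1` -/

/-- **NO UNIT COMPANION for `470450be1`** (NOGO-parity verdict cell; `S⁰(470450be1) ≠ 0` =
`ResidualSelmerParityRecords.residualSelmerGroup_ne_bot_e470450be1`, census `#Sel₃ = 1`): every Tamagawa-`3`-free
good-at-`3` curve `A` with a `Γ_ℚ`-isomorphism `θ : A[3] ⥲ E[3]` has `#Sel₃(A) ≠ 1`. `E` good at `3` by `3 ∤ Δ(E₀)`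
(kernel). CONDITIONAL on the Poitou–Tate fact and `hMR`; per cell; nothing booked.
[cite: MazurRubin2007, Thm. 1.4] [cite: MazurRubin2015SelmerCompanions, Thm. 3.1 (iv)(b)]
[cite: Cremona2006, Table 1 (Cremona label 470450be1)] -/
theorem no_unit_companion_e470450be1 (hfact : poitouTate_selmerStructure_duality ℚ)
    (hMR : selmerLocalKer_iff_of_goodReduction_above)
    (W : WeierstrassCurve ℚ) [W.IsElliptic] [W.IsGloballyMinimal]
    (hI : integralModelInt W = ⟨1, 1, 1, 1162, 181531⟩)
    (hs : Nat.card (W.selmerGroup (3 : ℤ)) = 1)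
    (A : WeierstrassCurve ℚ) [A.IsElliptic] (θ : geomTorsion A (3 : ℤ) ≃+ geomTorsion W (3 : ℤ))
    (hθ : ∀ (σ : absoluteGaloisGroup ℚ) (P : geomTorsion A (3 : ℤ)), θ (σ • P) = σ • θ P)
    (hgoodA : ∀ v : HeightOneSpectrum (𝓞 ℚ), (3 : 𝓞 ℚ) ∈ v.asIdeal → A.HasGoodReductionAt v)
    (htamA : ¬ 3 ∣ A.tamagawaProduct) : Nat.card (A.selmerGroup (3 : ℤ)) ≠ 1 :=
  natCard_selmerGroup_ne_one_of_congr_of_residualSelmerGroup_ne_bot W A 3 hMR (by decide) θ hθ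
    (fun v hv ↦ ⟨hasGoodReductionAt_of_map_eq_of_not_dvd (p := 3) W (hI ▸ map_integralModelInt W)
      (by decide +kernel) v hv, hgoodA v (by exact_mod_cast hv)⟩)
    htamA (residualSelmerGroup_ne_bot_e470450be1 hfact W hI hs)

/-! ### `96446g1` -/

/-- **NO UNIT COMPANION for `96446g1`** (NOGO-parity verdict cell; `S⁰(96446g1) ≠ 0` =
`ResidualSelmerParityRecords.residualSelmerGroup_ne_bot_e96446g1`, census `#Sel₃ = 3`): every Tamagawa-`3`-free
good-at-`3` curve `A` with a `Γ_ℚ`-isomorphism `θ : A[3] ⥲ E[3]` has `#Sel₃(A) ≠ 1`. `E` good at `3` by `3 ∤ Δ(E₀)`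
(kernel). CONDITIONAL on the Poitou–Tate fact and `hMR`; per cell; nothing booked.
[cite: MazurRubin2007, Thm. 1.4] [cite: MazurRubin2015SelmerCompanions, Thm. 3.1 (iv)(b)]
[cite: Cremona2006, Table 1 (Cremona label 96446g1)] -/
theorem no_unit_companion_e96446g1 (hfact : poitouTate_selmerStructure_duality ℚ)
    (hMR : selmerLocalKer_iff_of_goodReduction_above)
    (W : WeierstrassCurve ℚ) [W.IsElliptic] [W.IsGloballyMinimal]
    (hI : integralModelInt W = ⟨1, 1, 1, 147, (-1717)⟩)
    (hs : Nat.card (W.selmerGroup (3 : ℤ)) = 3)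
    (A : WeierstrassCurve ℚ) [A.IsElliptic] (θ : geomTorsion A (3 : ℤ) ≃+ geomTorsion W (3 : ℤ))
    (hθ : ∀ (σ : absoluteGaloisGroup ℚ) (P : geomTorsion A (3 : ℤ)), θ (σ • P) = σ • θ P)
    (hgoodA : ∀ v : HeightOneSpectrum (𝓞 ℚ), (3 : 𝓞 ℚ) ∈ v.asIdeal → A.HasGoodReductionAt v)
    (htamA : ¬ 3 ∣ A.tamagawaProduct) : Nat.card (A.selmerGroup (3 : ℤ)) ≠ 1 :=
  natCard_selmerGroup_ne_one_of_congr_of_residualSelmerGroup_ne_bot W A 3 hMR (by decide) θ hθ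
    (fun v hv ↦ ⟨hasGoodReductionAt_of_map_eq_of_not_dvd (p := 3) W (hI ▸ map_integralModelInt W)
      (by decide +kernel) v hv, hgoodA v (by exact_mod_cast hv)⟩)
    htamA (residualSelmerGroup_ne_bot_e96446g1 hfact W hI hs)

end Summit.BirchSwinnertonDyer.Rank1Residual.X10.ResidualSelmerCompanionRecords

end
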